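import Summits.HodgeConjecture.HodgeConjecture.Theorems.R90S9InnerFormSec146Datum         -- ★ p862404 (p01): `DatumInputs`, `gammaSph` = Γ₀^{sph} and its `rfl` read-backs (`Rep′ = RepPrimeSph`, `m′ = mPrimeSph`, `tr′ = X.trPrime`, `traceL = X.traceL`)
import Summits.HodgeConjecture.HodgeConjecture.Theorems.R90S9ScopeF0P3Dictionary           -- ★ p862440 (p02): `cptTriv₀_iff_isKcSphericalClass` (F0P3's `K_c`-triviality guard IS membership in the scope), `RepPrimeClass = Cls` (rfl)
import Summits.HodgeConjecture.HodgeConjecture.Theorems.F0P3TraceFactorisationKcIdempotent  -- ★ p826033 (D): `trGp₀_tens₀_eq_zero_of_not_cptTriv₀_of_isMulLeftInvariant` (non-`K_c`-trivial classes have trace `0` on `f′_{S,∞} ⊗ f^S`)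
import HarnessLib

/-!
# R90-TF · S9 «InnerForm-13.3.6 (c)» — THE S9 HALF OF `sock_S9_chiExpansion_cm`: the guarded spectral expansion `θ_{G′}(f′) = Σ_{π′ ∈ Rep′_sph} m′(π′) tr′ π′ f′` AT `Γ₀^{sph} =
# gammaSph X` FROM AN ALL-CLASSES EXPANSION, by VANISHING off the `K_c`-spherical scope and RE-INDEXING along `Rep′_sph ↪ Rep′` (Rogawski 1990 §14.6 p. 244; §14.2 p. 232)

Cell `hodgecm-mathlib`, crux H413 (`stmt-HodgeConjecture-24833`, lane `--supports … --as helper`), route of record `HCCMUnconditional` (count-neutral).  Programme R90-TF,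
section S9 (base `R90-IF`); seat R90-IF-p05 (g0); DEAL of R90-IF-plan (g0) (R90 bus 2026-09-04T22:24:14Z): **p05 → `Theorems/R90S9ChiExpansionAtGammaSph.lean` — from an
ALL-CLASSES spectral expansion hypothesis on the guarded tests (`hspecAll`, the shape T1∕S8's discrete-spectrum law delivers for the compact quotient `G′(L⁺)\G′(𝔸)` — junction
J10 of the successor's list) DERIVE p04 (g2)'s guarded binder `hχ𝓕 : ∀ f′, 𝓕 f′ → Summable (π′ ↦ m′ π′ · tr′ π′ f′) ∧ Γ.traceL f′ = Σ' π′, m′ π′ · tr′ π′ f′` (★ p862413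
`R90S9Eq1462GuardedOfThm1461`, ★ p862431 `R90S9Sec146EvpOfLevelsGuarded`, BYTES VERBATIM) at `Γ := gammaSph … X`.**  THEOREMS ONLY (no `def`, no instance, no notation, no
named fact, no `sorry`); never imports a `Cruxes/…/Lines` module; namespace `Summit.HodgeConjecture.HodgeConjecture.R90.S9`; GENERIC in the datum's parameter bundle `X`, in the
test type `TG′` and the guard `𝓕`, and in the class character `χ` of the all-classes law.
HONEST LABEL: HC_CM is proved only modulo the 7 printed citations (2 remaining named inputs: hLiu418 = stmt-HodgeConjecture-24832, h413 = stmt-HodgeConjecture-24833)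
— until rung 0 closes.  Bookkeeping (vanishing + re-indexing of a `tsum`); proves no printed statement about automorphic forms; UNCONDITIONAL (no letter): the letters of the
trace side (ArchFinTraceSplit ∕ PH of ★ p862484, «ARCH» of the pin `X_cm.trPrime := Θ₀ ∘ tupleOf`) enter only through the HYPOTHESIS `htr`, discharged by their owners at `X_cm`.

## THE MATHEMATICS [Rogawski1990, §14.6 p. 244: «the sum is over all discrete `π′` … against `f′ = f′_∞ ⊗ …` with `f′_∞` bi-`K_c`-invariant only the `π′` with `π′_∞|_{K_c} ⊃ 𝟙`
contribute»; §14.2 p. 232]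
On a guarded test `f′` (bi-`K_c`-invariant pure tensor `f′_{S,∞} ⊗ f^S`), every discrete class `π′` on which the compact archimedean factor `K_c` does NOT act trivially has
`tr π′(f′) = 0` (★ (D) `trGp₀_tens₀_eq_zero_of_not_cptTriv₀`: `R(f′)` lands in the `K_c`-fixed vectors of the irreducible block, which are `0`; `K_c ⊴ G′(𝔸)`).  Hence in the
all-classes expansion `θ_{G′}(f′) = Σ'_{π′ ∈ Rep′} m(π′) tr π′(f′)` the summand is supported on the `K_c`-spherical classes `Rep′_sph = {π′ // IsKcSphericalClass π′}` (★ p862440: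
F0P3's guard `cptTriv₀` IS that predicate), and along the injection `Subtype.val : Rep′_sph ↪ Rep′` both the summability and the sum transfer (Mathlib
`Function.Injective.summable_iff` ∕ `Function.Injective.tsum_eq`).  With the datum's pin `tr′ π′ f′ = χ π′.1 f′` on `𝓕` (`htr`) and `m′_sph π′ = m′ π′.1` (`rfl`) this is
EXACTLY p04's `hχ𝓕` at `gammaSph X` (`Rep′`, `m′`, `tr′`, `traceL` read back by `rfl`, ★ p862404).

## CONTENTS (all proved; axioms TRIO)
* §1 `chiExpansion_gammaSph_of_allClasses` — THE DERIVATION, generic in the class character `χ : RepPrimeClass → TG′ → ℂ` of the all-classes law: hypotheses `hspecAll`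
  (summable all-classes expansion of `X.traceL` on `𝓕`), `hvan` (`χ c f′ = 0` off the scope, on `𝓕`), `htr` (`X.trPrime π′ f′ = χ π′.1 f′` on `𝓕`); conclusion = p04's `hχ𝓕` at
  `Γ := gammaSph … X`, bytes verbatim.  `chiExpansion_gammaSph_of_allClasses_levels` — the level-indexed form (`𝓕 : Λ → TG′ → Prop`, ★ p862431's binder).
* §2 at the semilocal tests of record `f′ = tens₀ S fS fT` (any realisation `f′ ↦ (S f′, fS f′, fT f′)` of the abstract tests): `trGp₀_tens₀_eq_zero_of_not_isKcSphericalClass`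
  (= `hvan` for `χ c f′ := trGp₀ … c (tens₀ …)`, ★ (D) + ★ p862440, any left-invariant `ν` — UNCONDITIONAL), and **`chiExpansion_gammaSph_of_allClasses_tens₀`** (§1 with that
  `χ`: only `hspecAll` — the T1∕S8 law at `tens₀` — and the pin `htr` remain; at `X_cm`, `htr` = `htrX` (`X_cm.trPrime := Θ₀ ∘ tupleOf`, S9-R-TG) + ★ p862484
  `trGp₀_tens₀_eq_archTr₀_mul_finprod_sph` on `S ⊇ S₀`).
[cite: Rogawski1990, §14.6 Thm. 14.6.4 p. 244; §14.2 p. 232; §14.5 p. 237] [cite: BorelJacquet1979, §4.6] [cite: Dixmier1977, §13.1.5] [cite: GelfandGraevPS1969, Ch. 1 §2]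
-/

set_option autoImplicit false
-- the mandated namespace repeats `HodgeConjecture.HodgeConjecture`, as in every `Theorems/*.lean` of this sub-problem
set_option linter.dupNamespace false

noncomputable section

open NumberField IsDedekindDomain MeasureTheory
open scoped Matrix MatrixGroups
open Literature.NumberTheory Literature.NumberTheory.Automorphic Literature.NumberTheory.Automorphic.UnitaryGroup
open Literature.NumberTheory.Rogawski1990
open Summit.HodgeConjecture.HodgeConjecture.Cruxes.H413
open Summit.HodgeConjecture.HodgeConjecture.Cruxes.H413.F0P3InnerFormClassificationV6
open Summit.HodgeConjecture.HodgeConjecture.Cruxes.H413.F0P3ClassTokensOfRecord (Cls cl rep)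
open Summit.HodgeConjecture.HodgeConjecture.Cruxes.H413.F0P3CompactTrivOfRecord (cptTriv₀)
open Summit.HodgeConjecture.HodgeConjecture.Cruxes.H413.F0P3TestFunctionsOfRecord (Unr₀)
open Summit.HodgeConjecture.HodgeConjecture.Cruxes.H413.F0P3SpectralSideOfRecord (trGp₀)
open Summit.HodgeConjecture.HodgeConjecture.Cruxes.H413.F0P3SemilocalTestFunctionsOfRecord (TestS₀ tens₀)
open Summit.HodgeConjecture.HodgeConjecture.Cruxes.H413.F0P3TraceFactorisationKcIdempotent (trGp₀_tens₀_eq_zero_of_not_cptTriv₀_of_isMulLeftInvariant)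
open Summit.HodgeConjecture.HodgeConjecture.Cruxes.H413.F0P3GlobalPacket Summit.HodgeConjecture.HodgeConjecture.Cruxes.H413.F0P3LocalPacketKit

namespace Summit.HodgeConjecture.HodgeConjecture.R90.S9

open InnerFormSec146

variable (TG' TG TH : Type) (L : Type) [Field L] [NumberField L] [IsCMField L] (ι : L →+* ℂ) (H : Matrix (Fin 3) (Fin 3) L) (T : GL (Fin 3) ℂ)
  (hT : (T : Matrix (Fin 3) (Fin 3) ℂ)ᴴ * H.map ι * (T : Matrix (Fin 3) (Fin 3) ℂ) = Literature.Geometry.ComplexHyperbolic.BallModel.J)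
  (μA : Measure (adelicGroupData (↥(maximalRealSubfield L)) L (IsCMField.complexConj L) 3 H).automorphicQuotient)
  [(adelicGroupData (↥(maximalRealSubfield L)) L (IsCMField.complexConj L) 3 H).IsAutomorphicMeasure μA]
  (Ξ : OneDimAutRepH L → PacketPrimeFin L H) {H' : Matrix (Fin 3) (Fin 3) L}
  (𝔩 : ∀ v : HeightOneSpectrum (𝓞 ↥(maximalRealSubfield L)), LocalPacketKit L H' v)
  (X : DatumInputs TG' TG TH L ι H T hT μA Ξ 𝔩)

/-! ## §1 The derivation at `gammaSph X`, generic in the all-classes character `χ` -/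

/-- **THE GUARDED SPECTRAL EXPANSION AT `Γ₀^{sph} = gammaSph X` FROM AN ALL-CLASSES EXPANSION** — p04 (g2)'s binder `hχ𝓕` of ★ p862413 ∕ ★ p862431 at `Γ := gammaSph … X`,
bytes verbatim.  Hypotheses, all on the guarded tests `𝓕` only: `hspecAll` — `X.traceL f′ = Σ'_{c ∈ Rep′} m′(c) · χ c f′`, summably, for some character `χ` on ALL discrete classes
(T1∕S8's discrete-spectrum law for the compact quotient, at the realised test function); `hvan` — `χ c f′ = 0` for every class `c` OFF the `K_c`-spherical scope (★ (D) at the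
semilocal tests, §2); `htr` — the datum's `tr′` IS `χ` on the scope (the pin `X_cm.trPrime := Θ₀ ∘ tupleOf` + ★ p862484, at `X_cm`).  Then the Γ₀^{sph}-summand `m′_sph π′ · tr′ π′ f′`
is the all-classes summand pulled back along the injection `Subtype.val : Rep′_sph ↪ Rep′`, off whose range the latter vanishes, so summability and the sum transfer
(`Function.Injective.summable_iff` ∕ `Function.Injective.tsum_eq`). [cite: Rogawski1990, §14.6 Thm. 14.6.4 p. 244; §14.2 p. 232] [cite: BorelJacquet1979, §4.6] -/
theorem chiExpansion_gammaSph_of_allClasses (𝓕 : TG' → Prop) (χ : RepPrimeClass L H μA → TG' → ℂ)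
    (hspecAll : ∀ f' : TG', 𝓕 f' →
      Summable (fun c : RepPrimeClass L H μA => (mPrime L H μA c : ℂ) * χ c f') ∧
        X.traceL f' = ∑' c : RepPrimeClass L H μA, (mPrime L H μA c : ℂ) * χ c f')
    (hvan : ∀ f' : TG', 𝓕 f' → ∀ c : RepPrimeClass L H μA, ¬ IsKcSphericalClass L ι H T hT μA c → χ c f' = 0)
    (htr : ∀ (π' : RepPrimeSph L ι H T hT μA) (f' : TG'), 𝓕 f' → X.trPrime π' f' = χ π'.1 f') :
    ∀ f' : TG', 𝓕 f' →
      Summable (fun π' : (gammaSph TG' TG TH L ι H T hT μA Ξ 𝔩 X).Rep' =>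
          ((gammaSph TG' TG TH L ι H T hT μA Ξ 𝔩 X).m' π' : ℂ) * (gammaSph TG' TG TH L ι H T hT μA Ξ 𝔩 X).tr' π' f') ∧
        (gammaSph TG' TG TH L ι H T hT μA Ξ 𝔩 X).traceL f' =
          ∑' π' : (gammaSph TG' TG TH L ι H T hT μA Ξ 𝔩 X).Rep',
            ((gammaSph TG' TG TH L ι H T hT μA Ξ 𝔩 X).m' π' : ℂ) * (gammaSph TG' TG TH L ι H T hT μA Ξ 𝔩 X).tr' π' f' := by
  intro f' hf'
  obtain ⟨hsum, hexp⟩ := hspecAll f' hf'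
  -- the all-classes summand vanishes off the range of `Subtype.val : Rep′_sph → Rep′`
  have hoff : ∀ c : RepPrimeClass L H μA, c ∉ Set.range (Subtype.val : RepPrimeSph L ι H T hT μA → RepPrimeClass L H μA) →
      (fun c : RepPrimeClass L H μA => (mPrime L H μA c : ℂ) * χ c f') c = 0 := by
    intro c hc
    have hnc : ¬ IsKcSphericalClass L ι H T hT μA c := fun h => hc ⟨⟨c, h⟩, rfl⟩
    show (mPrime L H μA c : ℂ) * χ c f' = 0
    rw [hvan f' hf' c hnc, mul_zero]
  have hsupp : Function.support (fun c : RepPrimeClass L H μA => (mPrime L H μA c : ℂ) * χ c f') ⊆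
      Set.range (Subtype.val : RepPrimeSph L ι H T hT μA → RepPrimeClass L H μA) := fun c hc => by
    by_contra hr
    exact hc (hoff c hr)
  -- the Γ₀^{sph} summand IS the all-classes summand pulled back along `Subtype.val`
  have hfun : (fun π' : RepPrimeSph L ι H T hT μA => (mPrimeSph L ι H T hT μA π' : ℂ) * X.trPrime π' f') =
      (fun c : RepPrimeClass L H μA => (mPrime L H μA c : ℂ) * χ c f') ∘ (Subtype.val : RepPrimeSph L ι H T hT μA → RepPrimeClass L H μA) := by
    funext π'
    simp only [Function.comp_apply, htr π' f' hf', mPrimeSph]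
  show Summable (fun π' : RepPrimeSph L ι H T hT μA => (mPrimeSph L ι H T hT μA π' : ℂ) * X.trPrime π' f') ∧
    X.traceL f' = ∑' π' : RepPrimeSph L ι H T hT μA, (mPrimeSph L ι H T hT μA π' : ℂ) * X.trPrime π' f'
  rw [hfun, hexp]
  exact ⟨(Subtype.val_injective.summable_iff hoff).2 hsum, (Subtype.val_injective.tsum_eq hsupp).symm⟩

/-- **LEVEL-INDEXED FORM** (★ p862431 `R90S9Sec146EvpOfLevelsGuarded`'s binder: `𝓕 : Λ → TG′ → Prop`, one guard per level): the same derivation levelwise.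
[cite: Rogawski1990, §14.6 Thm. 14.6.4 p. 244; §14.2 p. 232] -/
theorem chiExpansion_gammaSph_of_allClasses_levels {Λ : Type*} (𝓕 : Λ → TG' → Prop) (χ : RepPrimeClass L H μA → TG' → ℂ)
    (hspecAll : ∀ (l : Λ) (f' : TG'), 𝓕 l f' →
      Summable (fun c : RepPrimeClass L H μA => (mPrime L H μA c : ℂ) * χ c f') ∧
        X.traceL f' = ∑' c : RepPrimeClass L H μA, (mPrime L H μA c : ℂ) * χ c f')
    (hvan : ∀ (l : Λ) (f' : TG'), 𝓕 l f' → ∀ c : RepPrimeClass L H μA, ¬ IsKcSphericalClass L ι H T hT μA c → χ c f' = 0)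
    (htr : ∀ (l : Λ) (π' : RepPrimeSph L ι H T hT μA) (f' : TG'), 𝓕 l f' → X.trPrime π' f' = χ π'.1 f') :
    ∀ (l : Λ) (f' : TG'), 𝓕 l f' →
      Summable (fun π' : (gammaSph TG' TG TH L ι H T hT μA Ξ 𝔩 X).Rep' =>
          ((gammaSph TG' TG TH L ι H T hT μA Ξ 𝔩 X).m' π' : ℂ) * (gammaSph TG' TG TH L ι H T hT μA Ξ 𝔩 X).tr' π' f') ∧
        (gammaSph TG' TG TH L ι H T hT μA Ξ 𝔩 X).traceL f' =
          ∑' π' : (gammaSph TG' TG TH L ι H T hT μA Ξ 𝔩 X).Rep',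
            ((gammaSph TG' TG TH L ι H T hT μA Ξ 𝔩 X).m' π' : ℂ) * (gammaSph TG' TG TH L ι H T hT μA Ξ 𝔩 X).tr' π' f' :=
  fun l => chiExpansion_gammaSph_of_allClasses TG' TG TH L ι H T hT μA Ξ 𝔩 X (𝓕 l) χ (hspecAll l) (hvan l) fun π' f' hf' => htr l π' f' hf'

/-! ## §2 At the semilocal tests of record `f′ = tens₀ S fS fT` -/

section Semilocal

variable [MeasurableSpace (Gp L H).Adelic] [BorelSpace (Gp L H).Adelic] (ν : Measure (Gp L H).Adelic) [IsFiniteMeasureOnCompacts ν]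

/-- **A class OFF the `K_c`-spherical scope has trace `0` on every `f′_{S,∞} ⊗ f^S`** (`ν` left invariant): ★ (D) `trGp₀_tens₀_eq_zero_of_not_cptTriv₀` read through ★ p862440
`cptTriv₀_iff_isKcSphericalClass` — the `hvan` input of §1 for `χ c f′ := trGp₀ … c (tens₀ …)`.  UNCONDITIONAL. [cite: Rogawski1990, §14.6 p. 244] [cite: BorelJacquet1979, §4.6]
[cite: Dixmier1977, §13.1.5] -/
theorem trGp₀_tens₀_eq_zero_of_not_isKcSphericalClass [ν.IsMulLeftInvariant] (S : Finset (Places L)) (c : RepPrimeClass L H μA)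
    (fS : TestS₀ L H ι T hT S) (fT : Unr₀ L H S) (hc : ¬ IsKcSphericalClass L ι H T hT μA c) :
    trGp₀ (Gp L H) μA ν c (tens₀ S fS fT) = 0 :=
  trGp₀_tens₀_eq_zero_of_not_cptTriv₀_of_isMulLeftInvariant L H ι T hT μA ν S c fS fT fun h =>
    hc ((cptTriv₀_iff_isKcSphericalClass L ι H T hT μA c).1 h)

/-- **THE GUARDED SPECTRAL EXPANSION AT `gammaSph X` FOR SEMILOCAL TESTS OF RECORD** — §1 with `χ c f′ := trGp₀ … c (tens₀ (S f′) (fS f′) (fT f′))` for ANY realisation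
`f′ ↦ (S f′, fS f′, fT f′)` of the abstract tests as `f′_{S,∞} ⊗ f^S` (at `X_cm`: the pair type of S9-R-TG realised by `tens₀`): the vanishing off the scope is automatic
(`trGp₀_tens₀_eq_zero_of_not_isKcSphericalClass`, `ν` left invariant), so only the ALL-CLASSES LAW `hspecAll` (T1∕S8 at `tens₀`, junction J10) and the PIN `htr`
(`X.trPrime π′ f′ = trGp₀ … π′.1 (tens₀ …)` on `𝓕`; at `X_cm` = `htrX` + ★ p862484 on `S ⊇ S₀`) remain.  Conclusion = p04's `hχ𝓕` at `Γ := gammaSph … X`, bytes verbatim.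
[cite: Rogawski1990, §14.6 Thm. 14.6.4 p. 244; §14.2 p. 232; §14.5 p. 237] [cite: BorelJacquet1979, §4.6] -/
theorem chiExpansion_gammaSph_of_allClasses_tens₀ [ν.IsMulLeftInvariant] (𝓕 : TG' → Prop)
    (S : TG' → Finset (Places L)) (fS : ∀ f' : TG', TestS₀ L H ι T hT (S f')) (fT : ∀ f' : TG', Unr₀ L H (S f'))
    (hspecAll : ∀ f' : TG', 𝓕 f' →
      Summable (fun c : RepPrimeClass L H μA => (mPrime L H μA c : ℂ) * trGp₀ (Gp L H) μA ν c (tens₀ (S f') (fS f') (fT f'))) ∧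
        X.traceL f' = ∑' c : RepPrimeClass L H μA, (mPrime L H μA c : ℂ) * trGp₀ (Gp L H) μA ν c (tens₀ (S f') (fS f') (fT f')))
    (htr : ∀ (π' : RepPrimeSph L ι H T hT μA) (f' : TG'), 𝓕 f' → X.trPrime π' f' = trGp₀ (Gp L H) μA ν π'.1 (tens₀ (S f') (fS f') (fT f'))) :
    ∀ f' : TG', 𝓕 f' →
      Summable (fun π' : (gammaSph TG' TG TH L ι H T hT μA Ξ 𝔩 X).Rep' =>
          ((gammaSph TG' TG TH L ι H T hT μA Ξ 𝔩 X).m' π' : ℂ) * (gammaSph TG' TG TH L ι H T hT μA Ξ 𝔩 X).tr' π' f') ∧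
        (gammaSph TG' TG TH L ι H T hT μA Ξ 𝔩 X).traceL f' =
          ∑' π' : (gammaSph TG' TG TH L ι H T hT μA Ξ 𝔩 X).Rep',
            ((gammaSph TG' TG TH L ι H T hT μA Ξ 𝔩 X).m' π' : ℂ) * (gammaSph TG' TG TH L ι H T hT μA Ξ 𝔩 X).tr' π' f' :=
  chiExpansion_gammaSph_of_allClasses TG' TG TH L ι H T hT μA Ξ 𝔩 X 𝓕 (fun c f' => trGp₀ (Gp L H) μA ν c (tens₀ (S f') (fS f') (fT f'))) hspecAll
    (fun f' _ c hc => trGp₀_tens₀_eq_zero_of_not_isKcSphericalClass L ι H T hT μA ν (S f') c (fS f') (fT f') hc) htr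

end Semilocal

end Summit.HodgeConjecture.HodgeConjecture.R90.S9

end
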